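import Summits.Schanuel.Schanuel.Theorems.RootDecomp1KHeightBoundary03

/-!
(census-1 g34 ×0 RECORD PORT — part 04 of the kernel scratch «EFFECTIVE GLUE»: INSTRUMENT OFFER 87 L3547 / NOTE 87 L3548;
crit-1 g15 PRICE + AUDIT + PORT GO L3549, terms r87-(i)–(xi); scratch = HOME/census/tools/gen34/effglue/HeightBoundary04.lean
sha256 17ebc9cb165767818f3a10168082cc95f25b9bc883ede5e7f28cf8a175931197 (294 l); this file = that scratch byte for byte
below this provenance block (r87-(iii)); `--supports stmt-Schanuel-33364`, no `--cite`, no credit, no item decided; ×0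
height-type re-grading (K-R42 (vii′)); row 36 «W4» UNDECIDED OF RECORD ×1 unchanged; rung 0.)
-/

/-!
# RootDecomp1KHeightBoundary (part 04: §10–§12) — census-1 g34 kernel scratch «EFFECTIVE GLUE»: THE ARITHMETIC HALF OF
  THE EFFECTIVE-SIEGEL PROGRAMME (census Table 5 row M11) PROVED — the hypothesis-free road to `UpperComparisonExpAt P`
  REDUCED to ONE typed per-curve datum `EffSiegelFunctions P` (node 31's `SiegelFunctions P` WITH height budgets); the
  member `W4` re-threaded; a satisfiability probe (×0 re-grading; no decision; rung 0)

Part 03 (census-1 g33, «EXP-WINDOW») showed that node 12's boundary equivalence and row 36's «one currency» reading need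
only the ONE-SIDED effective ε-form `UpperComparisonExpAt P` (additive constant `exp (B/ε)`), and that a comparison in
the ORDER `b` of Siegel functions, `n·h(y) ≤ (k + c₀/b)·h(x) + exp (B·b)` for every `b ≥ 1`, gives it
(`upperComparisonExpAt_of_pow`).  The census booked the hypothesis-free road as the programme (E1) effective Riemann–Roch
with heights, (E2) minimal / characteristic polynomial with coefficient bounds, (E3) exceptional points via resultants
(COSTUME-CENSUS v91 Table 5 M11: BOOKED AS SIZED, NOT OFFERED).  THIS FILE proves, in the kernel, the part of that road
that is ARITHMETIC, and so pins exactly what (E1)–(E3) must deliver: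

* §10 the per-curve datum `EffSiegelFunctions P` (definition with a parameter, NOT a print binder): node 31's
  `SiegelFunctions P` with the two monic relations EXPLICIT and THREE BUDGETS in the order `b`: `log relConst ≤ exp (B·b)`
  for each relation (`relConst` = node 31's archimedean constant `2·max(1,|D|)·(1 + Σ ‖χ_i‖₁)`) and
  `deg_Y P · h(y) ≤ exp (B·b)` at every rational point of the curve where `G·H` vanishes.  It refines the tree's
  predicate (`EffSiegelFunctions.siegelFunctions`).
* §11 LEMMA H WITH ITS CONSTANT (node 31's `logHt_le_of_rels` re-proved with the constant exposed,
  `logHt_le_of_rels_explicit`: `b·h(y) ≤ a·h(x) + log (relConst₁ · relConst₂)`).  (Part 05 reads the budget in naive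
  heights — `log relConst ≤ log 2 + 2·log T + log (1 + m·(a·m + 1))` — and proves the datum for node 31's toy `parabP`.)
* §12 THE GLUE THEOREM `upperComparisonExpAt_of_effSiegel : Irreducible (ratModel P) → EffSiegelFunctions P →
  UpperComparisonExpAt P` (through the per-`b` form `upperComparison_pow_of_effSiegel`, `B' = |B| + log (2·deg_Y P + 1)`,
  and part 03's `upperComparisonExpAt_of_pow`); hence THEOREM C″ modulo the datum
  (`thinFibreAt_iff_levelFinite_boundary_of_effSiegel`) and the member
  `thinFibreAt_two_W4P_iff_levelFinite_of_effSiegel (hW : EffSiegelFunctions W4P) : ThinFibreAt 2 W4P ↔ LevelFinite W4P`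
  (`ratModel W4P` irreducible from part 02's hypothesis-free `geomIrreducible_W4P`).

HONEST SCOPE.  ×0 by class (height-type re-grading, K-R42 (vii′)); NO decision: row 36 «W4» stays UNDECIDED OF RECORD ×1,
payable only by a hypothesis-free `LevelFinite W4P` / `ThinFibreAt 2 W4P`.  What the file adds to the record: the
effective-Siegel programme M11 is ONE typed geometric-effective statement per curve — `EffSiegelFunctions P` for
geometrically irreducible `P` of positive degrees = (E1) + (E2) + (E3) with the budgets above (relation coefficients
`exp (exp (O(b)))`, exceptional heights `exp (O(b))`) — and every arithmetic step from there to THEOREM C″ is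
kernel-checked.  `EffSiegelFunctions P` is NOT proved here for any curve of positive genus (in particular not for `W4`);
it is used ONLY as an explicit hypothesis.  Nothing here proves Schanuel, `FiniteOrderLiouvilleSchanuel` (33364), 33363,
31077, 31987, `ThinFibre 2`, `ThinFibreAt 2 W4P` or `LevelFinite W4P`.  Imports: part 03 only.  No Literature import,
no sorry, no set_option, no private, no instance, no notation.
-/

noncomputable section

namespace Summit.Schanuel.Schanuel.Theorems.RootDecomp1KHeightBoundary

open Polynomial LiouvilleNumber
open scoped Nat Polynomial.Bivariate
open Summit.Schanuel.Schanuel.Theorems.RootDecomp1KDegreeLadder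
open Summit.Schanuel.Schanuel.Theorems.RootDecomp1KLevelFinite (LevelFinite)
open Summit.Schanuel.Schanuel.Theorems.RootDecomp1KHeightGrading
open Summit.Schanuel.Schanuel.Theorems.RootDecomp1KSubspaceBranch (PadicSubspace)
open Summit.Schanuel.Schanuel.Theorems.RootDecomp1KOddEmpty (W4P)
open Summit.Schanuel.Schanuel.Theorems.RootDecomp1KW4Dossier (natDegree_W4P xdeg_W4P thinFibreAt_W4P_of_padicSubspace)
open Summit.Schanuel.Schanuel.Theorems.RootDecomp1KSiegelFunctions

/-! ### §10  The effective Siegel datum: node 31's `SiegelFunctions P` with height budgets in the order `b` -/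

/-- [auxiliary predicate] (definition with a parameter, not a fact): **EFFECTIVE SIEGEL FUNCTIONS ON THE CURVE `P = 0`**
— node 31's geometric datum `SiegelFunctions P` with the two monic relations made explicit and THREE budgets in the order
`b` of the Siegel functions: there are `c₀ : ℕ` and `B : ℝ` such that for every `b ≥ 1` there are `a` with
`a·deg_Y P ≤ b·xdeg P + c₀`, `G, H ∈ ℤ[x][Y]` not divisible by `P` over `ℚ`, a relation `(m₁, D₁, χ₁)` for `G/H` and a
relation `(m₂, D₂, χ₂)` for `G·Y^b/H` (nonzero integer top coefficients, `deg χ_i ≤ a·i`, `P ∣ relPoly` over `ℚ`) with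
(budget 1–2) `log relConst m_j D_j χ_j ≤ exp (B·b)` (`relConst` = node 31's archimedean constant
`2·max(1,|D|)·(1 + Σ_i ‖χ_i‖₁)` — so the relations' COEFFICIENT HEIGHTS may be doubly exponential in `b`) and (budget 3)
`deg_Y P · h(y) ≤ exp (B·b)` at every rational point of `P = 0` at which `G·H` vanishes (the exceptional points).  This is
what an EFFECTIVE Riemann–Roch construction of `φ_b ∈ L(a·(x)_∞ − b·(y)_∞)` with height control delivers ((E1)–(E3) of the
census's effective-Siegel programme); NOT proved in the tree for any curve of positive genus; used below ONLY as an explicit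
hypothesis (and PROVED for node 31's toy `parabP` in part 05). -/
def EffSiegelFunctions (P : ℤ[X][X]) : Prop :=
  ∃ (c₀ : ℕ) (B : ℝ), ∀ b : ℕ, 1 ≤ b →
    ∃ (a : ℕ) (G H : ℤ[X][X]) (m₁ : ℕ) (D₁ : ℤ) (χ₁ : ℕ → ℤ[X]) (m₂ : ℕ) (D₂ : ℤ) (χ₂ : ℕ → ℤ[X]),
      a * P.natDegree ≤ b * xdeg P + c₀ ∧ ¬ QDvd P G ∧ ¬ QDvd P H ∧
      (D₁ ≠ 0 ∧ (∀ i, (χ₁ i).natDegree ≤ a * i) ∧ QDvd P (relPoly m₁ D₁ χ₁ G H)) ∧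
      (D₂ ≠ 0 ∧ (∀ i, (χ₂ i).natDegree ≤ a * i) ∧ QDvd P (relPoly m₂ D₂ χ₂ (G * X ^ b) H)) ∧
      Real.log (relConst m₁ D₁ χ₁) ≤ Real.exp (B * b) ∧ Real.log (relConst m₂ D₂ χ₂) ≤ Real.exp (B * b) ∧
      (∀ x y : ℚ, bev P x y = 0 → bev (G * H) x y = 0 → (P.natDegree : ℝ) * logHt y ≤ Real.exp (B * b))

/-- the effective datum REFINES node 31's: `EffSiegelFunctions P → SiegelFunctions P` (forget the relations' coefficients
and the budgets). -/
theorem EffSiegelFunctions.siegelFunctions {P : ℤ[X][X]} (h : EffSiegelFunctions P) : SiegelFunctions P := by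
  obtain ⟨c₀, B, hb⟩ := h
  refine ⟨c₀, fun b hb1 => ?_⟩
  obtain ⟨a, G, H, m₁, D₁, χ₁, m₂, D₂, χ₂, hab, hG, hH, ⟨hD₁, hχ₁, hdvd₁⟩, ⟨hD₂, hχ₂, hdvd₂⟩, -, -, -⟩ := hb b hb1
  exact ⟨a, G, H, hab, hG, hH, ⟨m₁, D₁, χ₁, hD₁, hχ₁, hdvd₁⟩, ⟨m₂, D₂, χ₂, hD₂, hχ₂, hdvd₂⟩⟩

/-! ### §11  LEMMA H with its constant exposed -/

/-- `|D| ≤ relConst m D χ / 2` (`relConst = 2·max(1,|D|)·(1 + Σ ‖χ_i‖₁)` and the sum is nonnegative). -/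
theorem abs_le_half_relConst (m : ℕ) (D : ℤ) (χ : ℕ → ℤ[X]) : |(D : ℝ)| ≤ relConst m D χ / 2 := by
  unfold relConst
  have h1 : |(D : ℝ)| ≤ max 1 |(D : ℝ)| := le_max_right _ _
  have h2 : (1 : ℝ) ≤ 1 + ∑ i ∈ Finset.Icc 1 m, l1 (χ i) :=
    le_add_of_nonneg_right (Finset.sum_nonneg fun i _ => l1_nonneg _)
  have h3 : (0 : ℝ) ≤ max 1 |(D : ℝ)| := le_trans zero_le_one (le_max_left _ _)
  nlinarith

/-- **LEMMA H, EXPLICIT** (node 31's `logHt_le_of_rels` with the constant exposed): two monic relations — one for `t ≠ 0`,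
one for `t·y^b` — with lower coefficients of degree `≤ a·i` force
`b·h(y) ≤ a·h(x) + log (relConst m₁ D₁ χ₁ · relConst m₂ D₂ χ₂)`.
(`u₁ = D₁den(x)^a t`, `u₂ = D₂den(x)^a t y^b` are integers of size `≤ K_j·H(x)^a`, `y^b = u₂D₁/(u₁D₂)`, and
`K₂|D₁| + K₁|D₂| ≤ K₁K₂` by `abs_le_half_relConst`.) -/
theorem logHt_le_of_rels_explicit {a b m₁ m₂ : ℕ} (hm₁ : 1 ≤ m₁) (hm₂ : 1 ≤ m₂) {D₁ D₂ : ℤ} (hD₁ : D₁ ≠ 0)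
    (hD₂ : D₂ ≠ 0) {χ₁ χ₂ : ℕ → ℤ[X]} (hχ₁ : ∀ i, (χ₁ i).natDegree ≤ a * i)
    (hχ₂ : ∀ i, (χ₂ i).natDegree ≤ a * i) {x y t : ℚ} (ht : t ≠ 0)
    (h₁ : (D₁ : ℚ) * t ^ m₁ + ∑ i ∈ Finset.Icc 1 m₁, (aeval x (χ₁ i) : ℚ) * t ^ (m₁ - i) = 0)
    (h₂ : (D₂ : ℚ) * (t * y ^ b) ^ m₂ +
        ∑ i ∈ Finset.Icc 1 m₂, (aeval x (χ₂ i) : ℚ) * (t * y ^ b) ^ (m₂ - i) = 0) :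
    (b : ℝ) * logHt y ≤ (a : ℝ) * logHt x + Real.log (relConst m₁ D₁ χ₁ * relConst m₂ D₂ χ₂) := by
  set K₁ := relConst m₁ D₁ χ₁ with hK₁
  set K₂ := relConst m₂ D₂ χ₂ with hK₂
  set M : ℝ := K₂ * |(D₁ : ℝ)| + K₁ * |(D₂ : ℝ)| with hM
  have hK₁2 : 2 ≤ K₁ := two_le_relConst m₁ D₁ χ₁
  have hK₂2 : 2 ≤ K₂ := two_le_relConst m₂ D₂ χ₂
  have hD₁' : (1 : ℝ) ≤ |(D₁ : ℝ)| := by exact_mod_cast Int.one_le_abs hD₁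
  have hD₂' : (1 : ℝ) ≤ |(D₂ : ℝ)| := by exact_mod_cast Int.one_le_abs hD₂
  have hM1 : 1 ≤ M := by rw [hM]; nlinarith
  -- `M ≤ K₁ K₂`
  have hMK : M ≤ K₁ * K₂ := by
    have e₁ : |(D₁ : ℝ)| ≤ K₁ / 2 := abs_le_half_relConst m₁ D₁ χ₁
    have e₂ : |(D₂ : ℝ)| ≤ K₂ / 2 := abs_le_half_relConst m₂ D₂ χ₂
    have p₁ : K₂ * |(D₁ : ℝ)| ≤ K₂ * (K₁ / 2) := mul_le_mul_of_nonneg_left e₁ (by linarith)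
    have p₂ : K₁ * |(D₂ : ℝ)| ≤ K₁ * (K₂ / 2) := mul_le_mul_of_nonneg_left e₂ (by linarith)
    rw [hM]; linarith
  obtain ⟨u₁, hu₁⟩ := exists_int_eq_of_rel hm₁ hχ₁ h₁
  obtain ⟨u₂, hu₂⟩ := exists_int_eq_of_rel hm₂ hχ₂ h₂
  have hb₁ := abs_le_of_rel hm₁ hχ₁ h₁
  have hb₂ := abs_le_of_rel hm₂ hχ₂ h₂
  rw [← hu₁, Rat.cast_intCast] at hb₁
  rw [← hu₂, Rat.cast_intCast] at hb₂
  have hs : (x.den : ℚ) ≠ 0 := by exact_mod_cast x.den_ne_zero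
  have hu₁0 : u₁ ≠ 0 := by
    rintro rfl
    simp only [Int.cast_zero] at hu₁
    exact (mul_ne_zero (mul_ne_zero (Int.cast_ne_zero.mpr hD₁) (pow_ne_zero _ hs)) ht) hu₁.symm
  have hV : u₁ * D₂ ≠ 0 := mul_ne_zero hu₁0 hD₂
  have hyb : y ^ b = ((u₂ * D₁ : ℤ) : ℚ) / ((u₁ * D₂ : ℤ) : ℚ) := by
    push_cast
    rw [hu₁, hu₂]
    field_simp
  have hHa : 0 < HtQ x ^ a := pow_pos (HtQ_pos x) a
  have hmax : max |((u₂ * D₁ : ℤ) : ℝ)| |((u₁ * D₂ : ℤ) : ℝ)| ≤ M * HtQ x ^ a := by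
    push_cast
    rw [abs_mul, abs_mul]
    have e₁ : |(u₂ : ℝ)| * |(D₁ : ℝ)| ≤ K₂ * HtQ x ^ a * |(D₁ : ℝ)| :=
      mul_le_mul_of_nonneg_right hb₂ (abs_nonneg _)
    have e₂ : |(u₁ : ℝ)| * |(D₂ : ℝ)| ≤ K₁ * HtQ x ^ a * |(D₂ : ℝ)| :=
      mul_le_mul_of_nonneg_right hb₁ (abs_nonneg _)
    have p₁ : 0 ≤ |(u₂ : ℝ)| * |(D₁ : ℝ)| := by positivity
    have p₂ : 0 ≤ |(u₁ : ℝ)| * |(D₂ : ℝ)| := by positivity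
    refine max_le ?_ ?_ <;> rw [hM] <;> nlinarith
  have hVpos : 0 < max |((u₂ * D₁ : ℤ) : ℝ)| |((u₁ * D₂ : ℤ) : ℝ)| :=
    lt_max_of_lt_right (abs_pos.mpr (by exact_mod_cast hV))
  have hMpos : 0 < M := by linarith
  calc (b : ℝ) * logHt y = Real.log (HtQ (y ^ b)) := by rw [HtQ_pow, Real.log_pow, logHt_eq_log_HtQ]
    _ ≤ Real.log (max |((u₂ * D₁ : ℤ) : ℝ)| |((u₁ * D₂ : ℤ) : ℝ)|) := by
        rw [hyb]; exact Real.log_le_log (HtQ_pos _) (HtQ_intDiv_le _ _ hV)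
    _ ≤ Real.log (M * HtQ x ^ a) := Real.log_le_log hVpos hmax
    _ = (a : ℝ) * logHt x + Real.log M := by
        rw [Real.log_mul hMpos.ne' hHa.ne', Real.log_pow, logHt_eq_log_HtQ]; ring
    _ ≤ (a : ℝ) * logHt x + Real.log (K₁ * K₂) := by
        have := Real.log_le_log hMpos hMK
        linarith

/-! ### §12  The glue theorem: `EffSiegelFunctions P → UpperComparisonExpAt P` (for `P` irreducible over `ℚ`) -/

/-- the budget arithmetic: `exp (B·b) · (2n + 1) ≤ exp ((|B| + log (2n + 1)) · b)` for `b ≥ 1`. -/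
theorem exp_mul_budget_le (B : ℝ) (n : ℕ) {b : ℕ} (hb : 1 ≤ b) :
    Real.exp (B * b) * (2 * (n : ℝ) + 1) ≤ Real.exp ((|B| + Real.log (2 * (n : ℝ) + 1)) * b) := by
  have hb' : (1 : ℝ) ≤ b := by exact_mod_cast hb
  have hn : (0 : ℝ) < 2 * (n : ℝ) + 1 := by positivity
  have hL : 0 ≤ Real.log (2 * (n : ℝ) + 1) := Real.log_nonneg (by linarith)
  have e1 : Real.exp (B * b) ≤ Real.exp (|B| * b) :=
    Real.exp_le_exp.mpr (mul_le_mul_of_nonneg_right (le_abs_self B) (by linarith))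
  have e2 : 2 * (n : ℝ) + 1 ≤ Real.exp (Real.log (2 * (n : ℝ) + 1) * b) := by
    calc 2 * (n : ℝ) + 1 = Real.exp (Real.log (2 * (n : ℝ) + 1)) := (Real.exp_log hn).symm
      _ ≤ Real.exp (Real.log (2 * (n : ℝ) + 1) * b) :=
          Real.exp_le_exp.mpr (by nlinarith)
  rw [add_mul, Real.exp_add]
  exact mul_le_mul e1 e2 hn.le (Real.exp_pos _).le

/-- **THE GLUE THEOREM, per-`b` form**: if `P` is irreducible over `ℚ` and carries EFFECTIVE Siegel functions, then for
every `b ≥ 1` and every rational point of `P = 0`: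
`deg_Y P · h(y) ≤ (xdeg P + c₀/b)·h(x) + exp ((|B| + log (2·deg_Y P + 1))·b)`.
Proof = node 31's `upperComparisonAt_of_siegelFunctions` with LEMMA H explicit: at a point with `G·H ≠ 0` the two
relations give `b·h(y) ≤ a·h(x) + log K₁ + log K₂ ≤ a·h(x) + 2·exp (B·b)`, and `a·n ≤ b·k + c₀`; at a point with
`G·H = 0` budget 3 applies directly (no Bézout count needed). -/
theorem upperComparison_pow_of_effSiegel {P : ℤ[X][X]} (hirr : Irreducible (ratModel P)) (hS : EffSiegelFunctions P) :
    ∃ (c₀ : ℕ) (B : ℝ), ∀ b : ℕ, 1 ≤ b → ∀ x y : ℚ, bev P x y = 0 →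
      (P.natDegree : ℝ) * logHt y ≤
        ((xdeg P : ℝ) + (c₀ : ℝ) / b) * logHt x + Real.exp ((|B| + Real.log (2 * (P.natDegree : ℝ) + 1)) * b) := by
  obtain ⟨c₀, B, hS⟩ := hS
  refine ⟨c₀, B, fun b hb1 x y hxy => ?_⟩
  obtain ⟨a, G, H, m₁, D₁, χ₁, m₂, D₂, χ₂, hab, hG, hH, ⟨hD₁, hχ₁, hdvd₁⟩, ⟨hD₂, hχ₂, hdvd₂⟩, hK₁, hK₂, hexc⟩ :=
    hS b hb1
  set n : ℝ := (P.natDegree : ℝ) with hn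
  have hn0 : 0 ≤ n := Nat.cast_nonneg _
  have hx0 : 0 ≤ logHt x := logHt_nonneg x
  have hy0 : 0 ≤ logHt y := logHt_nonneg y
  have hb0 : (0 : ℝ) < b := by exact_mod_cast hb1
  have hbud := exp_mul_budget_le B P.natDegree hb1
  have hE0 : 0 < Real.exp (B * b) := Real.exp_pos _
  have hmain0 : 0 ≤ ((xdeg P : ℝ) + (c₀ : ℝ) / b) * logHt x := mul_nonneg (by positivity) hx0
  by_cases hGH : bev (G * H) x y = 0
  · -- exceptional point: budget 3
    have h1 := hexc x y hxy hGH
    nlinarith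
  · -- generic point: the two relations at `t = G(x,y)/H(x,y) ≠ 0`
    have hP : (ratModel P).evalEval x y = 0 := (bev_eq_zero_iff_ratModel P x y).mp hxy
    have hGH' : (ratModel (G * H)).evalEval x y ≠ 0 := fun h => hGH ((bev_eq_zero_iff_ratModel _ x y).mpr h)
    rw [ratModel_mul, evalEval_mul] at hGH'
    have hG0 : (ratModel G).evalEval x y ≠ 0 := fun h => hGH' (by rw [h, zero_mul])
    have hH0 : (ratModel H).evalEval x y ≠ 0 := fun h => hGH' (by rw [h, mul_zero])
    have ht : (ratModel G).evalEval x y / (ratModel H).evalEval x y ≠ 0 := div_ne_zero hG0 hH0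
    have hm₁ := one_le_of_qdvd_relPoly hirr hD₁ hdvd₁
    have hm₂ := one_le_of_qdvd_relPoly hirr hD₂ hdvd₂
    have h₁ := rel_at_point hdvd₁ hP hH0
    have h₂ := rel_at_point hdvd₂ hP hH0
    have ht2 : (ratModel (G * X ^ b)).evalEval x y / (ratModel H).evalEval x y =
        (ratModel G).evalEval x y / (ratModel H).evalEval x y * y ^ b := by
      rw [ratModel_mul, ratModel_pow, ratModel_X, evalEval_mul, evalEval_pow, evalEval_X]
      ring
    rw [ht2] at h₂
    have hH := logHt_le_of_rels_explicit (b := b) hm₁ hm₂ hD₁ hD₂ hχ₁ hχ₂ ht h₁ h₂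
    -- `log (K₁ K₂) = log K₁ + log K₂ ≤ 2·exp (B b)`
    have hK₁pos : 0 < relConst m₁ D₁ χ₁ := relConst_pos _ _ _
    have hK₂pos : 0 < relConst m₂ D₂ χ₂ := relConst_pos _ _ _
    have hlog : Real.log (relConst m₁ D₁ χ₁ * relConst m₂ D₂ χ₂) ≤ 2 * Real.exp (B * b) := by
      rw [Real.log_mul hK₁pos.ne' hK₂pos.ne']; linarith
    -- `a·n ≤ b·(k + c₀/b)`
    have hab' : (a : ℝ) * n ≤ (b : ℝ) * ((xdeg P : ℝ) + (c₀ : ℝ) / b) := by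
      have h := (Nat.cast_le (α := ℝ)).mpr hab
      push_cast at h
      have e : (b : ℝ) * ((xdeg P : ℝ) + (c₀ : ℝ) / b) = (b : ℝ) * (xdeg P : ℝ) + c₀ := by
        field_simp
      rw [e, hn]; linarith
    have e1 : (b : ℝ) * (n * logHt y) ≤ (b : ℝ) * (((xdeg P : ℝ) + (c₀ : ℝ) / b) * logHt x + 2 * n * Real.exp (B * b)) := by
      have hb1' : (1 : ℝ) ≤ b := by exact_mod_cast hb1
      have h2n : 0 ≤ 2 * n * Real.exp (B * b) := by positivity
      calc (b : ℝ) * (n * logHt y) = n * ((b : ℝ) * logHt y) := by ring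
        _ ≤ n * ((a : ℝ) * logHt x + 2 * Real.exp (B * b)) :=
            mul_le_mul_of_nonneg_left (hH.trans (by linarith)) hn0
        _ = (a : ℝ) * n * logHt x + 2 * n * Real.exp (B * b) := by ring
        _ ≤ (b : ℝ) * ((xdeg P : ℝ) + (c₀ : ℝ) / b) * logHt x + (b : ℝ) * (2 * n * Real.exp (B * b)) :=
            add_le_add (mul_le_mul_of_nonneg_right hab' hx0) (le_mul_of_one_le_left h2n hb1')
        _ = (b : ℝ) * (((xdeg P : ℝ) + (c₀ : ℝ) / b) * logHt x + 2 * n * Real.exp (B * b)) := by ring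
    have e2 := le_of_mul_le_mul_left e1 hb0
    nlinarith

/-- **THE GLUE THEOREM**: `EffSiegelFunctions P → UpperComparisonExpAt P` for `P` irreducible over `ℚ` — the ARITHMETIC
HALF of the effective-Siegel programme, PROVED (part 03's `upperComparisonExpAt_of_pow` on the per-`b` form). -/
theorem upperComparisonExpAt_of_effSiegel {P : ℤ[X][X]} (hirr : Irreducible (ratModel P)) (hS : EffSiegelFunctions P) :
    UpperComparisonExpAt P := by
  obtain ⟨c₀, B, h⟩ := upperComparison_pow_of_effSiegel hirr hS
  exact upperComparisonExpAt_of_pow (c₀ := (c₀ : ℝ)) (B := |B| + Real.log (2 * (P.natDegree : ℝ) + 1)) h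

/-- the glue for a GEOMETRICALLY IRREDUCIBLE curve of positive `Y`-degree (irreducibility over `ℚ` by node 31's
`irreducible_ratModel_of_geomIrreducible`). -/
theorem upperComparisonExpAt_of_effSiegel' {P : ℤ[X][X]} (hgi : GeomIrreducible P) (hn : 1 ≤ P.natDegree)
    (hS : EffSiegelFunctions P) : UpperComparisonExpAt P :=
  upperComparisonExpAt_of_effSiegel (irreducible_ratModel_of_geomIrreducible hgi hn) hS

/-- **THEOREM C″ modulo the effective Siegel datum**: on the boundary `deg_Y P = m₀ · xdeg P` (`xdeg P ≥ 1`) of a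
geometrically irreducible curve carrying effective Siegel functions, `ThinFibreAt m₀ P ↔ LevelFinite P`. -/
theorem thinFibreAt_iff_levelFinite_boundary_of_effSiegel {P : ℤ[X][X]} (hgi : GeomIrreducible P)
    (hS : EffSiegelFunctions P) (hk : 1 ≤ xdeg P) {m₀ : ℕ} (hm : 1 ≤ m₀) (heq : P.natDegree = m₀ * xdeg P) :
    ThinFibreAt m₀ P ↔ LevelFinite P :=
  thinFibreAt_iff_levelFinite_boundary_of_exp
    (upperComparisonExpAt_of_effSiegel' hgi (by rw [heq]; exact Nat.mul_le_mul hm hk) hS) hk heq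

/-- `ratModel W4P` is irreducible (from part 02's hypothesis-free `geomIrreducible_W4P`). -/
theorem irreducible_ratModel_W4P : Irreducible (ratModel W4P) :=
  irreducible_ratModel_of_geomIrreducible geomIrreducible_W4P (by rw [natDegree_W4P]; norm_num)

/-- the weakened hypothesis on `W4` from the effective Siegel datum: `EffSiegelFunctions W4P → UpperComparisonExpAt W4P`. -/
theorem upperComparisonExpAt_W4P_of_effSiegel (hW : EffSiegelFunctions W4P) : UpperComparisonExpAt W4P :=
  upperComparisonExpAt_of_effSiegel irreducible_ratModel_W4P hW

/-- **THE MEMBER (per curve, effective datum)**: `EffSiegelFunctions W4P → (ThinFibreAt 2 W4P ↔ LevelFinite W4P)` — the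
«one currency» reading of row 36 modulo the ONE geometric-effective statement `EffSiegelFunctions W4P` (NOT proved;
row 36 stays UNDECIDED OF RECORD). -/
theorem thinFibreAt_two_W4P_iff_levelFinite_of_effSiegel (hW : EffSiegelFunctions W4P) :
    ThinFibreAt 2 W4P ↔ LevelFinite W4P :=
  thinFibreAt_two_W4P_iff_levelFinite_of_exp (upperComparisonExpAt_W4P_of_effSiegel hW)

/-- level finiteness for `W4` from node 11's binder and the effective Siegel datum:
`PadicSubspace → EffSiegelFunctions W4P → LevelFinite W4P` (neither hypothesis proved in the tree). -/
theorem levelFinite_W4P_of_padicSubspace_of_effSiegel (hS : PadicSubspace) (hW : EffSiegelFunctions W4P) :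
    LevelFinite W4P :=
  levelFinite_W4P_of_padicSubspace_of_exp hS (upperComparisonExpAt_W4P_of_effSiegel hW)

end Summit.Schanuel.Schanuel.Theorems.RootDecomp1KHeightBoundary

end
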